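import Summits.AtomisticToContinuum.HydrodynamicLimit.Theses.BoxDissipativeWeakStrong
import Literature.Analysis.FunctionSpaces.TorusCalculusProofs
import Literature.Analysis.FunctionSpaces.TorusSpaceTime
import HarnessLib

/-!
# Crux `FluxClosure` (stmt-AtomisticToContinuum-9902, route BoxDissipativeWeakStrong), line `registered`,
# rung-0 piece E2: the limit defect vanishes at constant fields

Support file (`--supports stmt-AtomisticToContinuum-9902`) of the lead prover of the crux
`Summit.AtomisticToContinuum.HydrodynamicLimit.Theses.BoxDissipativeWeakStrong.FluxClosure`, equilibrium
(rung-0) programme, registered sub-goal E2 `homogeneous_limitDefect_eq_zero`: the crux's pathwise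
momentum-balance defect functional EVALUATED AT CONSTANT FIELDS — momentum `m`, density `r`, pressure `p`
constants — vanishes identically for every `w` jointly smooth on the slab `[0,T) × 𝕋³` and every
`τ ∈ [0,T)`:

`∫⟪m, w τ⟫ - ∫⟪m, w 0⟫ - ∫_{(0,τ]} ∫ (⟪m, ∂ₜw⟫ + Σᵢⱼ (mᵢmⱼ/r) ∂ⱼwᵢ + p div w) = 0`.

Proof (pure torus calculus, all ingredients in the tree): for `t ∈ [0,T)` the space integral of the
integrand is `⟪m, ∫ ∂ₜw(t,·)⟫`, because `∫ ∂ⱼ(wᵢ(t,·)) = 0` (`Torus.integral_partialDeriv_eq_zero_holds`)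
and `∫ div w(t,·) = 0` (`Torus.integral_divergence_eq_zero_holds`); `s ↦ ∫ w(s,·)` has one-sided derivative
`∫ ∂ₜw(s,·)` within `[0,T)` (`Torus.IsSmoothSpaceTimeOn.hasDerivWithinAt_integral`), continuous on the slab
(`IsSmoothSpaceTimeOn.timeDerivWithin`, `continuousOn_integral`), so the fundamental theorem of calculus on
`[0,τ] ⊂ [0,T)` (`intervalIntegral.integral_eq_sub_of_hasDeriv_right_of_le`) identifies the time integral
with `⟪m, ∫ w τ⟫ - ⟪m, ∫ w 0⟫ = ∫⟪m, w τ⟫ - ∫⟪m, w 0⟫` (`integral_inner`). No definitions; sources: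
L. C. Evans, *Partial Differential Equations* (2010), App. C.2 Thm. 1 (no boundary on `𝕋³`).
-/

noncomputable section

namespace Summit.AtomisticToContinuum.HydrodynamicLimit.Theorems
namespace FluxClosureEq
namespace E2

open scoped BigOperators Topology Classical MeasureTheory InnerProductSpace ENNReal
open Filter Set Function MeasureTheory
open Literature.MathematicalPhysics.KineticTheory Literature.Analysis.FluidPDE Literature.Analysis.FunctionSpaces

/-- Slice identity at constant fields: for `w` jointly smooth on `[0,T) × 𝕋³` and `t ∈ [0,T)`, the space
integral of `⟪m, ∂ₜw⟫ + Σᵢⱼ (mᵢmⱼ/r) ∂ⱼwᵢ + p div w` is `⟪m, ∫ ∂ₜw(t,·)⟫` (the two divergence-type terms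
integrate to zero on the torus). -/
theorem e2_integral_slice_eq {T : ℝ} (r p : ℝ) (m : V3) {w : ℝ → T3 → V3}
    (hw : Torus.IsSmoothSpaceTimeOn (Ico 0 T) w) {t : ℝ} (ht : t ∈ Ico 0 T) :
    (∫ x, (inner ℝ m (Torus.timeDerivWithin (Ico 0 T) w t x) +
        (∑ i, ∑ j, m i * m j / r * Torus.partialDeriv j (fun y => w t y i) x) +
        p * Torus.divergence (w t) x)) =
      inner ℝ m (∫ x, Torus.timeDerivWithin (Ico 0 T) w t x) := by
  have hU : UniqueDiffOn ℝ (Ico (0 : ℝ) T) := uniqueDiffOn_Ico 0 T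
  have hwt : Torus.IsSmooth (w t) := hw.isSmooth_slice ht
  have hdt : Torus.IsSmooth (Torus.timeDerivWithin (Ico 0 T) w t) :=
    (hw.timeDerivWithin hU).isSmooth_slice ht
  have hA : Integrable (fun x => inner ℝ m (Torus.timeDerivWithin (Ico 0 T) w t x)) :=
    hdt.integrable.const_inner m
  have hBij : ∀ i j : Fin 3,
      Integrable (fun x => m i * m j / r * Torus.partialDeriv j (fun y => w t y i) x) :=
    fun i j => ((hwt.apply i).partialDeriv j).integrable.const_mul _
  have hBi : ∀ i : Fin 3,
      Integrable (fun x => ∑ j, m i * m j / r * Torus.partialDeriv j (fun y => w t y i) x) :=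
    fun i => integrable_finsetSum _ fun j _ => hBij i j
  have hB : Integrable
      (fun x => ∑ i, ∑ j, m i * m j / r * Torus.partialDeriv j (fun y => w t y i) x) :=
    integrable_finsetSum _ fun i _ => hBi i
  have hC : Integrable (fun x => p * Torus.divergence (w t) x) :=
    hwt.divergence.integrable.const_mul p
  have hAB : Integrable (fun x => inner ℝ m (Torus.timeDerivWithin (Ico 0 T) w t x) +
      ∑ i, ∑ j, m i * m j / r * Torus.partialDeriv j (fun y => w t y i) x) :=
    hA.add hB
  have hB0 : (∫ x, ∑ i, ∑ j, m i * m j / r * Torus.partialDeriv j (fun y => w t y i) x) = 0 := by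
    rw [integral_finsetSum _ fun i _ => hBi i]
    refine Finset.sum_eq_zero fun i _ => ?_
    rw [integral_finsetSum _ fun j _ => hBij i j]
    refine Finset.sum_eq_zero fun j _ => ?_
    rw [integral_const_mul, Torus.integral_partialDeriv_eq_zero_holds (hwt.apply i) j, mul_zero]
  have hC0 : (∫ x, p * Torus.divergence (w t) x) = 0 := by
    rw [integral_const_mul, Torus.integral_divergence_eq_zero_holds hwt, mul_zero]
  rw [integral_add hAB hC, integral_add hA hB, hB0, hC0, add_zero, add_zero,
    integral_inner hdt.integrable m]

/-- Rung-0 piece E2 of the crux `FluxClosure` (registered sub-goal, verbatim): the crux's momentum-balance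
defect functional evaluated at CONSTANT fields (momentum `m`, density `r`, pressure `p`) vanishes for
every `w` jointly smooth on `[0,T) × 𝕋³` and every `τ ∈ [0,T)`. Proof: the slice identity
`e2_integral_slice_eq`, differentiation under `∫_{𝕋³}` within `[0,T)`
(`Torus.IsSmoothSpaceTimeOn.hasDerivWithinAt_integral`) and the fundamental theorem of calculus on
`[0,τ]`. -/
theorem homogeneous_limitDefect_eq_zero : ∀ (T r p : ℝ) (m : V3) (w : ℝ → T3 → V3), Torus.IsSmoothSpaceTimeOn (Ico 0 T) w → ∀ τ ∈ Ico 0 T, (∫ x, inner ℝ m (w τ x)) - (∫ x, inner ℝ m (w 0 x)) - (∫ t in Ioc 0 τ, ∫ x, (inner ℝ m (Torus.timeDerivWithin (Ico 0 T) w t x) + (∑ i, ∑ j, m i * m j / r * Torus.partialDeriv j (fun y => w t y i) x) + p * Torus.divergence (w t) x)) = 0 := by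
  intro T r p m w hw τ hτ
  have hU : UniqueDiffOn ℝ (Ico (0 : ℝ) T) := uniqueDiffOn_Ico 0 T
  have h0T : (0 : ℝ) ∈ Ico 0 T := ⟨le_rfl, hτ.1.trans_lt hτ.2⟩
  have hIcc : Icc 0 τ ⊆ Ico 0 T := Icc_subset_Ico_right hτ.2
  have hw' : Torus.IsSmoothSpaceTimeOn (Ico 0 T) (Torus.timeDerivWithin (Ico 0 T) w) :=
    hw.timeDerivWithin hU
  -- the primitive `s ↦ ⟪m, ∫ w(s,·)⟫`, its one-sided derivative within `[0,T)`, and the FTC on `[0,τ]`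
  have hderiv : ∀ s ∈ Ico 0 T,
      HasDerivWithinAt (fun s => inner ℝ m (∫ x, w s x))
        (inner ℝ m (∫ x, Torus.timeDerivWithin (Ico 0 T) w s x)) (Ico 0 T) s := by
    intro s hs
    have h1 : HasDerivWithinAt (fun s => ∫ x, w s x)
        (∫ x, Torus.timeDerivWithin (Ico 0 T) w s x) (Ico 0 T) s :=
      hw.hasDerivWithinAt_integral (convex_Ico 0 T) hs
    simpa using (hasDerivWithinAt_const s (Ico 0 T) m).inner ℝ h1
  have hcont : ContinuousOn (fun s => inner ℝ m (∫ x, w s x)) (Icc 0 τ) :=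
    fun s hs => ((hderiv s (hIcc hs)).continuousWithinAt).mono hIcc
  have hgcont : ContinuousOn (fun s => inner ℝ m (∫ x, Torus.timeDerivWithin (Ico 0 T) w s x))
      (Icc 0 τ) :=
    (continuousOn_const.inner (hw'.continuousOn_integral (convex_Ico 0 T))).mono hIcc
  have hFTC : (∫ s in (0 : ℝ)..τ, inner ℝ m (∫ x, Torus.timeDerivWithin (Ico 0 T) w s x)) =
      inner ℝ m (∫ x, w τ x) - inner ℝ m (∫ x, w 0 x) :=
    intervalIntegral.integral_eq_sub_of_hasDeriv_right_of_le hτ.1 hcont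
      (fun s hs => ((hderiv s ⟨hs.1.le, hs.2.trans hτ.2⟩).hasDerivAt
        (Ico_mem_nhds hs.1 (hs.2.trans hτ.2))).hasDerivWithinAt)
      (hgcont.intervalIntegrable_of_Icc hτ.1)
  -- replace the time integrand on `(0, τ]` by `⟪m, ∫ ∂ₜw(t,·)⟫` (slice identity) and conclude
  have hI : (∫ t in Ioc 0 τ, ∫ x, (inner ℝ m (Torus.timeDerivWithin (Ico 0 T) w t x) +
        (∑ i, ∑ j, m i * m j / r * Torus.partialDeriv j (fun y => w t y i) x) +
        p * Torus.divergence (w t) x)) =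
      ∫ t in Ioc 0 τ, inner ℝ m (∫ x, Torus.timeDerivWithin (Ico 0 T) w t x) :=
    setIntegral_congr_fun measurableSet_Ioc fun t ht =>
      e2_integral_slice_eq r p m hw ⟨ht.1.le, ht.2.trans_lt hτ.2⟩
  rw [hI, ← intervalIntegral.integral_of_le hτ.1, hFTC,
    integral_inner (hw.isSmooth_slice hτ).integrable m,
    integral_inner (hw.isSmooth_slice h0T).integrable m, sub_self]

end E2
end FluxClosureEq
end Summit.AtomisticToContinuum.HydrodynamicLimit.Theorems

end
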